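import Summits.ABC.IUTFork.Cor312LicenceTripleLocalTypeSlot
import Summits.ABC.IUTFork.Conditional.WRowFrey37569208117GapThirtyCells
import Summits.ABC.IUTFork.Conditional.WRowFrey37569208117GapFifteen
import Summits.ABC.IUTFork.Conditional.GenuineKExactTameLocalType
import HarnessLib

/-!
# R-W WINDOW-TABLE «W:GAP-1019», INHABITED HALF (B) — `7¹¹·19 + 5¹²·1019·7151² = 2²⁸·3¹²·11³·67` at `l = 1019`: the hull licence S_H HOLDS at
# every genuine Θ-volume datum whose local type at `7` carries the twist factor (`e(K_x/ℚ₇) = 30·l`), e.g. whenever `√λ ∈ F`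

PROOF-ONLY file (D-0012; 0 definitions, 0 `Prop` facts, no instance) of the abc-iut cell — D-0079 RESCUE sub-cell R-W «WINDOW Θ-SIDE
INEQUALITY», seat abc-iut-w5-d009 (gen 14), row «W:GAP-1019» = the first TYPE-SPLIT row of the R-W table (abc-iut-plan rulings C-R83 (b) /
C-R87 (c); rw-num-lead «TS» block, row «TS-37569208117+12721777397216796875=…-l1019»). Half (A), REFUTED on the sub-class «no twist factor at 7»
(`e(K_x/ℚ₇) ∣ 15·l`), is this seat's `WRowFrey37569208117GapFifteen` (p494058: the floor-exact hull column FAILS at `(p, j) = (7, 509)`, margin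
`−3252225`). THIS file is half (B): on the complementary sub-class «twist factor at 7» (`e(K_x/ℚ₇) = 30·l = 30570`; by this seat's
`WRow.localType_seven_frey37569208117` the local type at `7` is `15·l` or `30·l`, nothing else) the licence HOLDS at every label and every bad
prime — abc-iut-W-row-1's HOOKED integer-slot socket `WRow.licence_triple_slot_of_localType` (`Cor312LicenceTripleLocalTypeSlot`, hook
`Q p e := (p = 7 → e = 30570)`; first consumer `WRowFrey73NineteenInhabitedHalf`) at this seat's cells `WRow.hcell_frey37569208117_gap1019_localType30`
(`WRowFrey37569208117GapThirtyCells`: at `7` the floor-free END cells at `e = 30570` are `−312845` (`j = 1`) and `−2043601` (`j = 509`), slot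
`⌊e/6⌋ = 5095`, exact envelope exponent `7⁵ − 5e = −136043`; the other primes as in the band file). §2 reads the sub-class off print's data: by
abc-iut-W-neg-2's exact tame type `GenuineK.absRamificationIdx_kOf_eq_thirty_mul_of_isSquare` (`t = v₇(abc) = 11`, `gcd(15, 11) = 1`,
`ord₇ λ = 11` ODD), every datum whose field `F` contains `√λ` — the cell's model reading `F = F‡(λ) = ℚ(√−1, √λ, √(λ−1), E_λ[15])`, the top of
print's range ([IUTchIV] Thm. 1.10 p. 22) — has `e(K_x/ℚ₇) = 30·l`, hence S_H; at the bottom of the range, print's `F = ℚ(√−1, E_λ[15])`, the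
desk reading gives `e = 15·l` and half (A) applies (that identification is NOT a theorem of the tree: half (A) keeps the local type as its
hypothesis). TAKES NO SIDE on [IUTchIII] Cor. 3.12 (S. Mochizuki, *Inter-universal Teichmüller theory III*, Cor. 3.12 p. 173–174; Step (xi-f)
p. 184) or on any author; «inhabited as typed» ≠ «asserted in print».

WHAT IS PROVED (namespace `Summit.ABC.IUTFork.Conditional`): §1 **`WRow.licence_frey37569208117_gap1019_of_thirty`** — every genuine Θ-volume datum
`T` at `(ratPoint (7¹¹·19/c), 1019)` whose places over `7` have `e(K_x/ℚ₇) = 30·1019`, every pair of realising Θ- and q-ideles: abc-iut-c312-1's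
`Thm311ToCor312.Licence` HOLDS at `settingPrVolSharp (pilotDataOfK T.D T.K) …`; **`WRow.exists_qPinned_and_hull_frey37569208117_gap1019_of_thirty`**
— branch C's «∃ ρ qK, QPinned ∧ PilotKummerCompatHull» there, any columns. §2 **`WRow.licence_frey37569208117_gap1019_of_isSquare`** /
**`WRow.exists_qPinned_and_hull_frey37569208117_gap1019_of_isSquare`** — the same for every datum with `√λ ∈ F` (`IsSquare (algebraMap F_tpd F λ)`).
READING (neutral; numbers, not adjectives): together with half (A) the Szpiro-bad gap datum `(λ, 1019)` of this triple is DECIDED ON BOTH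
SUB-CLASSES of its local type at `7` — REFUTED at `15·l`, INHABITED at `30·l` — and the sub-class is a function of the datum's field `F`, not of
`(λ, l)`: OUR typed window clause S_H is F-DEPENDENT at this datum. Admissibility / (P6) / Szpiro-badness and NON-EMPTINESS of either sub-class
are NOT claimed (if both halves were ever proved ∀T at one cell the honest consequence would be `IsEmpty` of the datum type, C-R87 (c)).
HONEST SCOPE: OUR sharp containers; STRONGER-THAN-PRINT hull reading; nothing about the printed inequality, the number-level corollary or any
author's intended hull; typed ≠ proved; instantiated ≠ endorsed; no abc claim.
[cite: Mochizuki2012, IUTchI Def. 3.1 (b),(c) pp. 61–62, Ex. 3.2 (iv) p. 71; IUTchIII Cor. 3.12 Step (xi-f) p. 184; IUTchIV Prop. 1.1 p. 9, Prop. 1.2 (i)(ii) p. 10, Thm. 1.10 p. 22, proof Steps (ii)–(iii) p. 24–26, Cor. 2.2 (ii) proof (P5) p. 46]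
[cite: DupuyHilado2025, §3.3, §3.4, §4.9, §4.12] [cite: SerreLocalFields1979, Ch. IV §2 Cor. 1 of Prop. 7] [cite: SilvermanATAEC1994, V.5 Thm. 5.3 and Cor. 5.4]
[claim: Mochizuki2012, status: disputed] for every IUT sentence.
-/

noncomputable section

open Set Function Metric NumberField IsDedekindDomain

namespace Summit.ABC.IUTFork.Conditional

open Thm311 Thm311.Real Cor312 Cor312Vol Cor312Prov Literature.IUT.LogThetaLattice Literature.IUT.LogVolume
  Literature.IUT.HodgeTheaters Literature.IUT.LogVolume.Cor22
open Literature.NumberTheory.NumberFields Literature.NumberTheory.GaloisRepresentations.Ultrametric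
open Literature.NumberTheory.DiophantineGeometry Literature.NumberTheory.DiophantineGeometry.GenEll

/-! ## §1. The twisted sub-class `e(·|7) = 30·l`: S_H INHABITED at `(ratPoint (7¹¹·19/c), 1019)` -/

/-- **«W:GAP-1019», INHABITED HALF (B): `7¹¹·19 + 5¹²·1019·7151² = 2²⁸·3¹²·11³·67` at `l = 1019`, data WITH the twist factor at `7`.** For every
genuine Θ-volume datum `T` at `(ratPoint (7¹¹·19/c), 1019)` whose places over `7` have `e(K_x/ℚ₇) = 30·1019` and every pair of Θ- and q-ideles
realising the pilot divisors of `X := pilotDataOfK T.D T.K`: abc-iut-c312-1's `Thm311ToCor312.Licence` HOLDS at abc-iut-c312-7's `settingPrVolSharp X …`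
— abc-iut-W-row-1's hooked socket `WRow.licence_triple_slot_of_localType` (hook `p = 7 → e = 30570`, discharged by `hloc`) at
`WRow.hcell_frey37569208117_gap1019_localType30`. [cite: Mochizuki2012, IUTchI Def. 3.1 (b),(c) pp. 61–62, Ex. 3.2 (iv) p. 71; IUTchIII Cor. 3.12 Step (xi-f) p. 184; IUTchIV Prop. 1.1 p. 9, Prop. 1.2 (i)(ii) p. 10, Cor. 2.2 (ii) proof (P5) p. 46]
[cite: DupuyHilado2025, §3.3, §3.4, §4.9, §4.12] [claim: Mochizuki2012, status: disputed] -/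
theorem WRow.licence_frey37569208117_gap1019_of_thirty (T : Cor22.ThetaVolumeDatumAt (ratPoint (((7 ^ 11 * 19 : ℕ) : ℚ) / (2 ^ 28 * 3 ^ 12 * 11 ^ 3 * 67 : ℕ))) 1019)
    (hloc : letI := T.instFieldF; letI := T.instNumberFieldF; letI := T.instAlgebraF; letI := T.instFieldK
      letI := T.instNumberFieldK; letI := T.instAlgebraK; letI := T.instFieldFbar; letI := T.instAlgebraFbar
      letI := T.instAlgebraKFbar; letI := T.instIsElliptic
      haveI : Fact (Nat.Prime 7) := ⟨by norm_num⟩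
      ∀ x₀ : (thetaIndex (pilotDataOfK T.D T.K)).Fibre (.inr ⟨7, by norm_num⟩),
        absRamificationIdx 7 (kOf (pilotDataOfK T.D T.K) 7 x₀) = 30 * 1019) :
    letI := T.instFieldF; letI := T.instNumberFieldF; letI := T.instAlgebraF; letI := T.instFieldK
    letI := T.instNumberFieldK; letI := T.instAlgebraK; letI := T.instFieldFbar; letI := T.instAlgebraFbar
    letI := T.instAlgebraKFbar; letI := T.instIsElliptic
    ∀ {logv : PadicLogs T.K} (hlog : LogvAnalytic logv) (M : Type) [Field M] [NumberField M]
      (archPk : ∀ (j : (thetaIndex (pilotDataOfK T.D T.K)).Label) (vQ : (thetaIndex (pilotDataOfK T.D T.K)).VQ),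
        Set ((logShellsDH (pilotDataOfK T.D T.K) logv).Packet j vQ))
      (archSub : ∀ (j : (thetaIndex (pilotDataOfK T.D T.K)).Label) (v : (thetaIndex (pilotDataOfK T.D T.K)).V),
        Set ((logShellsDH (pilotDataOfK T.D T.K) logv).Packet j ((thetaIndex (pilotDataOfK T.D T.K)).over v)))
      (Ψ : ℤ → ∀ v : (thetaIndex (pilotDataOfK T.D T.K)).V, v ∈ (thetaIndex (pilotDataOfK T.D T.K)).Vbad →
        Set ((logShellsDH (pilotDataOfK T.D T.K) logv).StarPacket v))
      (act : ℤ → ∀ v : (thetaIndex (pilotDataOfK T.D T.K)).V, v ∈ (thetaIndex (pilotDataOfK T.D T.K)).Vbad →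
        (logShellsDH (pilotDataOfK T.D T.K) logv).StarPacket v → Module.End ℚ ((logShellsDH (pilotDataOfK T.D T.K) logv).StarPacket v))
      (Mmod : ℤ → ∀ j : (thetaIndex (pilotDataOfK T.D T.K)).LabelStar, Set ((logShellsDH (pilotDataOfK T.D T.K) logv).GlobalPacket j.1))
      (region : ℤ → ∀ j : (thetaIndex (pilotDataOfK T.D T.K)).LabelStar, FinDivisor M → ∀ vQ : (thetaIndex (pilotDataOfK T.D T.K)).VQ,
        Set ((logShellsDH (pilotDataOfK T.D T.K) logv).Packet j.1 vQ))
      (n : ℤ) {HT : Type} {LogLink : HT → HT → Type} {IsFull : ∀ {s t : HT}, LogLink s t → Prop}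
      (lat : LGPGaussianLogThetaLattice LogLink IsFull)
      {Frd : Type} {IsoF : Frd → Frd → Type} {Ob : Frd → Type} {realify : Frd → Frd} {Strip : Type}
      {IsoS : Strip → Strip → Type} {Mv : ∀ v : (thetaIndex (pilotDataOfK T.D T.K)).V, v ∈ (thetaIndex (pilotDataOfK T.D T.K)).Vbad → Type}
      [∀ v h, Monoid (Mv v h)]
      (sig : GlobalLGPFrobenioidSignature (thetaIndex (pilotDataOfK T.D T.K)).lstar (thetaIndex (pilotDataOfK T.D T.K)).V
        (· ∈ (thetaIndex (pilotDataOfK T.D T.K)).Vbad) Frd IsoF Ob realify Strip IsoS Mv)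
      (split : SplittingMonoids Mv) {ObΔ : Type} {N : ∀ v : (thetaIndex (pilotDataOfK T.D T.K)).V, v ∈ (thetaIndex (pilotDataOfK T.D T.K)).Vbad → Type}
      [∀ v h, Monoid (N v h)] (qData : QPilotData ObΔ N)
      (tq : ∀ (pp : Nat.Primes) (x : (thetaIndex (pilotDataOfK T.D T.K)).Fibre (.inr pp)),
        haveI : Fact (pp : ℕ).Prime := ⟨pp.2⟩; kOf (pilotDataOfK T.D T.K) pp.1 x)
      (t : ∀ (pp : Nat.Primes) (_ : Fin (pilotDataOfK T.D T.K).lstar) (x : (thetaIndex (pilotDataOfK T.D T.K)).Fibre (.inr pp)),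
        haveI : Fact (pp : ℕ).Prime := ⟨pp.2⟩; kOf (pilotDataOfK T.D T.K) pp.1 x)
      (htq0 : ∀ pp x, tq pp x ≠ 0)
      (htq1 : ∀ (pp : Nat.Primes) (x : (thetaIndex (pilotDataOfK T.D T.K)).Fibre (.inr pp)),
        haveI : Fact (pp : ℕ).Prime := ⟨pp.2⟩; placeOf (pilotDataOfK T.D T.K) pp.1 x ∉ (pilotDataOfK T.D T.K).S → ‖tq pp x‖ = 1)
      (_ht0 : ∀ pp i x, t pp i x ≠ 0)
      (_ht : ∀ (pp : Nat.Primes) (i : Fin (pilotDataOfK T.D T.K).lstar) (x : (thetaIndex (pilotDataOfK T.D T.K)).Fibre (.inr pp)),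
        haveI : Fact (pp : ℕ).Prime := ⟨pp.2⟩
        Real.log ‖t pp i x‖ = -((pilotDataOfK T.D T.K).thetaPilot i (placeOf (pilotDataOfK T.D T.K) pp.1 x)) *
          logNorm T.K (placeOf (pilotDataOfK T.D T.K) pp.1 x) / localDegree T.K (placeOf (pilotDataOfK T.D T.K) pp.1 x))
      (_htq : ∀ (pp : Nat.Primes) (x : (thetaIndex (pilotDataOfK T.D T.K)).Fibre (.inr pp)),
        haveI : Fact (pp : ℕ).Prime := ⟨pp.2⟩
        Real.log ‖tq pp x‖ = -((pilotDataOfK T.D T.K).qPilot (placeOf (pilotDataOfK T.D T.K) pp.1 x)) *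
          logNorm T.K (placeOf (pilotDataOfK T.D T.K) pp.1 x) / localDegree T.K (placeOf (pilotDataOfK T.D T.K) pp.1 x)),
      Thm311ToCor312.Licence
        (settingPrVolSharp (pilotDataOfK T.D T.K) hlog M archPk archSub Ψ act Mmod region n lat sig split qData tq t htq0 htq1) :=
  WRow.licence_triple_slot_of_localType isABCTriple_frey37569208117
    (by rw [Cor22.jInv_ratPoint_triple isABCTriple_frey37569208117]; norm_num) T
    (fun p => if p = 3 then 5 else if p = 5 then 4 else if p = 7 then 5 else if p = 11 then 1 else 0)
    (fun p => if p = 3 then 6 else if p = 5 then 5 else if p = 7 then 6 else if p = 11 then 2 else 1) (fun p e => p = 7 → e = 30570)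
    (by
      intro pp x _ hpp
      obtain rfl : pp = ⟨7, by norm_num⟩ := Subtype.ext hpp
      exact (hloc x).trans (by norm_num)) WRow.hcell_frey37569208117_gap1019_localType30

/-- **Hence branch C's per-datum antecedent «∃ ρ qK, QPinned ∧ PilotKummerCompatHull» HOLDS** at every such datum (any columns `col`; every
pair of realising Θ- and q-ideles, the CHOSEN ones of the window certificates' `hSHw`/`hSHwBad` binders included).
[cite: Mochizuki2012, IUTchIII Cor. 3.12 Step (xi-d) p. 183, (xi-f) p. 184] [cite: DupuyHilado2025, §3.3, §3.4, §4.9] [claim: Mochizuki2012, status: disputed] -/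
theorem WRow.exists_qPinned_and_hull_frey37569208117_gap1019_of_thirty (T : Cor22.ThetaVolumeDatumAt (ratPoint (((7 ^ 11 * 19 : ℕ) : ℚ) / (2 ^ 28 * 3 ^ 12 * 11 ^ 3 * 67 : ℕ))) 1019)
    (hloc : letI := T.instFieldF; letI := T.instNumberFieldF; letI := T.instAlgebraF; letI := T.instFieldK
      letI := T.instNumberFieldK; letI := T.instAlgebraK; letI := T.instFieldFbar; letI := T.instAlgebraFbar
      letI := T.instAlgebraKFbar; letI := T.instIsElliptic
      haveI : Fact (Nat.Prime 7) := ⟨by norm_num⟩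
      ∀ x₀ : (thetaIndex (pilotDataOfK T.D T.K)).Fibre (.inr ⟨7, by norm_num⟩),
        absRamificationIdx 7 (kOf (pilotDataOfK T.D T.K) 7 x₀) = 30 * 1019) :
    letI := T.instFieldF; letI := T.instNumberFieldF; letI := T.instAlgebraF; letI := T.instFieldK
    letI := T.instNumberFieldK; letI := T.instAlgebraK; letI := T.instFieldFbar; letI := T.instAlgebraFbar
    letI := T.instAlgebraKFbar; letI := T.instIsElliptic
    ∀ {logv : PadicLogs T.K} (hlog : LogvAnalytic logv) (M : Type) [Field M] [NumberField M]
      (archPk : ∀ (j : (thetaIndex (pilotDataOfK T.D T.K)).Label) (vQ : (thetaIndex (pilotDataOfK T.D T.K)).VQ),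
        Set ((logShellsDH (pilotDataOfK T.D T.K) logv).Packet j vQ))
      (archSub : ∀ (j : (thetaIndex (pilotDataOfK T.D T.K)).Label) (v : (thetaIndex (pilotDataOfK T.D T.K)).V),
        Set ((logShellsDH (pilotDataOfK T.D T.K) logv).Packet j ((thetaIndex (pilotDataOfK T.D T.K)).over v)))
      (Ψ : ℤ → ∀ v : (thetaIndex (pilotDataOfK T.D T.K)).V, v ∈ (thetaIndex (pilotDataOfK T.D T.K)).Vbad →
        Set ((logShellsDH (pilotDataOfK T.D T.K) logv).StarPacket v))
      (act : ℤ → ∀ v : (thetaIndex (pilotDataOfK T.D T.K)).V, v ∈ (thetaIndex (pilotDataOfK T.D T.K)).Vbad →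
        (logShellsDH (pilotDataOfK T.D T.K) logv).StarPacket v → Module.End ℚ ((logShellsDH (pilotDataOfK T.D T.K) logv).StarPacket v))
      (Mmod : ℤ → ∀ j : (thetaIndex (pilotDataOfK T.D T.K)).LabelStar, Set ((logShellsDH (pilotDataOfK T.D T.K) logv).GlobalPacket j.1))
      (region : ℤ → ∀ j : (thetaIndex (pilotDataOfK T.D T.K)).LabelStar, FinDivisor M → ∀ vQ : (thetaIndex (pilotDataOfK T.D T.K)).VQ,
        Set ((logShellsDH (pilotDataOfK T.D T.K) logv).Packet j.1 vQ))
      (n : ℤ) {HT : Type} {LogLink : HT → HT → Type} {IsFull : ∀ {s t : HT}, LogLink s t → Prop}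
      (lat : LGPGaussianLogThetaLattice LogLink IsFull)
      {Frd : Type} {IsoF : Frd → Frd → Type} {Ob : Frd → Type} {realify : Frd → Frd} {Strip : Type}
      {IsoS : Strip → Strip → Type} {Mv : ∀ v : (thetaIndex (pilotDataOfK T.D T.K)).V, v ∈ (thetaIndex (pilotDataOfK T.D T.K)).Vbad → Type}
      [∀ v h, Monoid (Mv v h)]
      (sig : GlobalLGPFrobenioidSignature (thetaIndex (pilotDataOfK T.D T.K)).lstar (thetaIndex (pilotDataOfK T.D T.K)).V
        (· ∈ (thetaIndex (pilotDataOfK T.D T.K)).Vbad) Frd IsoF Ob realify Strip IsoS Mv)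
      (split : SplittingMonoids Mv) {ObΔ : Type} {N : ∀ v : (thetaIndex (pilotDataOfK T.D T.K)).V, v ∈ (thetaIndex (pilotDataOfK T.D T.K)).Vbad → Type}
      [∀ v h, Monoid (N v h)] (qData : QPilotData ObΔ N)
      (tq : ∀ (pp : Nat.Primes) (x : (thetaIndex (pilotDataOfK T.D T.K)).Fibre (.inr pp)),
        haveI : Fact (pp : ℕ).Prime := ⟨pp.2⟩; kOf (pilotDataOfK T.D T.K) pp.1 x)
      (t : ∀ (pp : Nat.Primes) (_ : Fin (pilotDataOfK T.D T.K).lstar) (x : (thetaIndex (pilotDataOfK T.D T.K)).Fibre (.inr pp)),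
        haveI : Fact (pp : ℕ).Prime := ⟨pp.2⟩; kOf (pilotDataOfK T.D T.K) pp.1 x)
      (htq0 : ∀ pp x, tq pp x ≠ 0)
      (htq1 : ∀ (pp : Nat.Primes) (x : (thetaIndex (pilotDataOfK T.D T.K)).Fibre (.inr pp)),
        haveI : Fact (pp : ℕ).Prime := ⟨pp.2⟩; placeOf (pilotDataOfK T.D T.K) pp.1 x ∉ (pilotDataOfK T.D T.K).S → ‖tq pp x‖ = 1)
      (col : ℤ → Column (logShellsDH (pilotDataOfK T.D T.K) logv))
      (_ht0 : ∀ pp i x, t pp i x ≠ 0)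
      (_ht : ∀ (pp : Nat.Primes) (i : Fin (pilotDataOfK T.D T.K).lstar) (x : (thetaIndex (pilotDataOfK T.D T.K)).Fibre (.inr pp)),
        haveI : Fact (pp : ℕ).Prime := ⟨pp.2⟩
        Real.log ‖t pp i x‖ = -((pilotDataOfK T.D T.K).thetaPilot i (placeOf (pilotDataOfK T.D T.K) pp.1 x)) *
          logNorm T.K (placeOf (pilotDataOfK T.D T.K) pp.1 x) / localDegree T.K (placeOf (pilotDataOfK T.D T.K) pp.1 x))
      (_htq : ∀ (pp : Nat.Primes) (x : (thetaIndex (pilotDataOfK T.D T.K)).Fibre (.inr pp)),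
        haveI : Fact (pp : ℕ).Prime := ⟨pp.2⟩
        Real.log ‖tq pp x‖ = -((pilotDataOfK T.D T.K).qPilot (placeOf (pilotDataOfK T.D T.K) pp.1 x)) *
          logNorm T.K (placeOf (pilotDataOfK T.D T.K) pp.1 x) / localDegree T.K (placeOf (pilotDataOfK T.D T.K) pp.1 x)),
      ∃ (ρ : (∀ v : (thetaIndex (pilotDataOfK T.D T.K)).V, v ∈ (thetaIndex (pilotDataOfK T.D T.K)).Vbad →
              Set ((logShellsDH (pilotDataOfK T.D T.K) logv).StarPacket v)) →
            ∀ (j : (thetaIndex (pilotDataOfK T.D T.K)).Label) (vQ : (thetaIndex (pilotDataOfK T.D T.K)).VQ),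
              Set ((logShellsDH (pilotDataOfK T.D T.K) logv).Packet j vQ))
          (qK : ∀ v : (thetaIndex (pilotDataOfK T.D T.K)).V, v ∈ (thetaIndex (pilotDataOfK T.D T.K)).Vbad →
            Set ((logShellsDH (pilotDataOfK T.D T.K) logv).StarPacket v)),
          QPinned ({ toSituation := situationPrVol (pilotDataOfK T.D T.K) hlog M archPk archSub Ψ act Mmod region, col := col } :
              LatticeSituation (thetaIndex (pilotDataOfK T.D T.K)))
            (settingPrVolSharp (pilotDataOfK T.D T.K) hlog M archPk archSub Ψ act Mmod region n lat sig split qData tq t htq0 htq1) ρ qK ∧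
          PilotKummerCompatHull ({ toSituation := situationPrVol (pilotDataOfK T.D T.K) hlog M archPk archSub Ψ act Mmod region, col := col } :
              LatticeSituation (thetaIndex (pilotDataOfK T.D T.K)))
            (settingPrVolSharp (pilotDataOfK T.D T.K) hlog M archPk archSub Ψ act Mmod region n lat sig split qData tq t htq0 htq1) ρ qK :=
  WRow.exists_qPinned_and_hull_triple_slot_of_localType isABCTriple_frey37569208117
    (by rw [Cor22.jInv_ratPoint_triple isABCTriple_frey37569208117]; norm_num) T
    (fun p => if p = 3 then 5 else if p = 5 then 4 else if p = 7 then 5 else if p = 11 then 1 else 0)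
    (fun p => if p = 3 then 6 else if p = 5 then 5 else if p = 7 then 6 else if p = 11 then 2 else 1) (fun p e => p = 7 → e = 30570)
    (by
      intro pp x _ hpp
      obtain rfl : pp = ⟨7, by norm_num⟩ := Subtype.ext hpp
      exact (hloc x).trans (by norm_num)) WRow.hcell_frey37569208117_gap1019_localType30

/-! ## §2. The model-clause reading: `√λ ∈ F` ⟹ `e(K_x/ℚ₇) = 30·1019` ⟹ S_H -/

/-- `ord₇ λ = 11` for `λ = 7¹¹·19/(2²⁸·3¹²·11³·67)`, at the place of `ℚ` over `7`: ODD. [folklore] -/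
private theorem ord_seven_lam (v : HeightOneSpectrum (𝓞 ℚ))
    (hv : Rat.HeightOneSpectrum.natGenerator v = ((⟨7, by norm_num⟩ : Nat.Primes) : ℕ)) :
    Odd (ord ℚ v ((((7 ^ 11 * 19 : ℕ) : ℚ) / (2 ^ 28 * 3 ^ 12 * 11 ^ 3 * 67 : ℕ) : ℚ))) := by
  have hq0 : ((((7 ^ 11 * 19 : ℕ) : ℚ) / (2 ^ 28 * 3 ^ 12 * 11 ^ 3 * 67 : ℕ) : ℚ)) ≠ 0 := by norm_num
  have ha : padicValNat 7 (7 ^ 11 * 19) = 11 := by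
    rw [padicValNat.mul (by norm_num) (by norm_num), padicValNat.prime_pow, padicValNat.eq_zero_of_not_dvd (by norm_num)]
  have hc : padicValNat 7 (2 ^ 28 * 3 ^ 12 * 11 ^ 3 * 67) = 0 := padicValNat.eq_zero_of_not_dvd (by norm_num)
  rw [GenuineK.ord_rat_eq_padicValRat v hq0, hv]
  rw [padicValRat.div (by norm_num) (by norm_num), padicValRat.of_nat, padicValRat.of_nat]
  simp only [ha, hc]
  decide

/-- **`√λ ∈ F` ⟹ S_H at `l = 1019`.** `T` a genuine Θ-volume datum at `(ratPoint (7¹¹·19/c), 1019)` whose field `F` contains a square root of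
`λ = 7¹¹·19/c` (the MODEL CLAUSE of the cell's reading `F = F‡(λ)`; the top of print's range [IUTchIV] Thm. 1.10 p. 22); EVERY pair of realising
ideles. THEN the licence HOLDS — abc-iut-W-neg-2's exact tame type `GenuineK.absRamificationIdx_kOf_eq_thirty_mul_of_isSquare` (`t = 11`,
`gcd(15, 11) = 1`, `ord₇ λ = 11` odd ⟹ `e(K_{x₀}/ℚ₇) = 30·1019`) feeds `WRow.licence_frey37569208117_gap1019_of_thirty`.
[cite: Mochizuki2012, IUTchIV Thm. 1.10 p. 22, proof Steps (ii)–(iii) p. 24–26; IUTchIII Cor. 3.12 Step (xi-f) p. 184] [cite: SerreLocalFields1979, Ch. IV §2 Cor. 1 of Prop. 7]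
[claim: Mochizuki2012, status: disputed] -/
theorem WRow.licence_frey37569208117_gap1019_of_isSquare (T : Cor22.ThetaVolumeDatumAt (ratPoint (((7 ^ 11 * 19 : ℕ) : ℚ) / (2 ^ 28 * 3 ^ 12 * 11 ^ 3 * 67 : ℕ))) 1019)
    (hsq : letI := T.instFieldF; letI := T.instAlgebraF
      IsSquare (algebraMap (ratPoint (((7 ^ 11 * 19 : ℕ) : ℚ) / (2 ^ 28 * 3 ^ 12 * 11 ^ 3 * 67 : ℕ))).F T.F
        ((((7 ^ 11 * 19 : ℕ) : ℚ) / (2 ^ 28 * 3 ^ 12 * 11 ^ 3 * 67 : ℕ) : ℚ)))) :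
    letI := T.instFieldF; letI := T.instNumberFieldF; letI := T.instAlgebraF; letI := T.instFieldK
    letI := T.instNumberFieldK; letI := T.instAlgebraK; letI := T.instFieldFbar; letI := T.instAlgebraFbar
    letI := T.instAlgebraKFbar; letI := T.instIsElliptic
    ∀ {logv : PadicLogs T.K} (hlog : LogvAnalytic logv) (M : Type) [Field M] [NumberField M]
      (archPk : ∀ (j : (thetaIndex (pilotDataOfK T.D T.K)).Label) (vQ : (thetaIndex (pilotDataOfK T.D T.K)).VQ),
        Set ((logShellsDH (pilotDataOfK T.D T.K) logv).Packet j vQ))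
      (archSub : ∀ (j : (thetaIndex (pilotDataOfK T.D T.K)).Label) (v : (thetaIndex (pilotDataOfK T.D T.K)).V),
        Set ((logShellsDH (pilotDataOfK T.D T.K) logv).Packet j ((thetaIndex (pilotDataOfK T.D T.K)).over v)))
      (Ψ : ℤ → ∀ v : (thetaIndex (pilotDataOfK T.D T.K)).V, v ∈ (thetaIndex (pilotDataOfK T.D T.K)).Vbad →
        Set ((logShellsDH (pilotDataOfK T.D T.K) logv).StarPacket v))
      (act : ℤ → ∀ v : (thetaIndex (pilotDataOfK T.D T.K)).V, v ∈ (thetaIndex (pilotDataOfK T.D T.K)).Vbad →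
        (logShellsDH (pilotDataOfK T.D T.K) logv).StarPacket v → Module.End ℚ ((logShellsDH (pilotDataOfK T.D T.K) logv).StarPacket v))
      (Mmod : ℤ → ∀ j : (thetaIndex (pilotDataOfK T.D T.K)).LabelStar, Set ((logShellsDH (pilotDataOfK T.D T.K) logv).GlobalPacket j.1))
      (region : ℤ → ∀ j : (thetaIndex (pilotDataOfK T.D T.K)).LabelStar, FinDivisor M → ∀ vQ : (thetaIndex (pilotDataOfK T.D T.K)).VQ,
        Set ((logShellsDH (pilotDataOfK T.D T.K) logv).Packet j.1 vQ))
      (n : ℤ) {HT : Type} {LogLink : HT → HT → Type} {IsFull : ∀ {s t : HT}, LogLink s t → Prop}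
      (lat : LGPGaussianLogThetaLattice LogLink IsFull)
      {Frd : Type} {IsoF : Frd → Frd → Type} {Ob : Frd → Type} {realify : Frd → Frd} {Strip : Type}
      {IsoS : Strip → Strip → Type} {Mv : ∀ v : (thetaIndex (pilotDataOfK T.D T.K)).V, v ∈ (thetaIndex (pilotDataOfK T.D T.K)).Vbad → Type}
      [∀ v h, Monoid (Mv v h)]
      (sig : GlobalLGPFrobenioidSignature (thetaIndex (pilotDataOfK T.D T.K)).lstar (thetaIndex (pilotDataOfK T.D T.K)).V
        (· ∈ (thetaIndex (pilotDataOfK T.D T.K)).Vbad) Frd IsoF Ob realify Strip IsoS Mv)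
      (split : SplittingMonoids Mv) {ObΔ : Type} {N : ∀ v : (thetaIndex (pilotDataOfK T.D T.K)).V, v ∈ (thetaIndex (pilotDataOfK T.D T.K)).Vbad → Type}
      [∀ v h, Monoid (N v h)] (qData : QPilotData ObΔ N)
      (tq : ∀ (pp : Nat.Primes) (x : (thetaIndex (pilotDataOfK T.D T.K)).Fibre (.inr pp)),
        haveI : Fact (pp : ℕ).Prime := ⟨pp.2⟩; kOf (pilotDataOfK T.D T.K) pp.1 x)
      (t : ∀ (pp : Nat.Primes) (_ : Fin (pilotDataOfK T.D T.K).lstar) (x : (thetaIndex (pilotDataOfK T.D T.K)).Fibre (.inr pp)),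
        haveI : Fact (pp : ℕ).Prime := ⟨pp.2⟩; kOf (pilotDataOfK T.D T.K) pp.1 x)
      (htq0 : ∀ pp x, tq pp x ≠ 0)
      (htq1 : ∀ (pp : Nat.Primes) (x : (thetaIndex (pilotDataOfK T.D T.K)).Fibre (.inr pp)),
        haveI : Fact (pp : ℕ).Prime := ⟨pp.2⟩; placeOf (pilotDataOfK T.D T.K) pp.1 x ∉ (pilotDataOfK T.D T.K).S → ‖tq pp x‖ = 1)
      (_ht0 : ∀ pp i x, t pp i x ≠ 0)
      (_ht : ∀ (pp : Nat.Primes) (i : Fin (pilotDataOfK T.D T.K).lstar) (x : (thetaIndex (pilotDataOfK T.D T.K)).Fibre (.inr pp)),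
        haveI : Fact (pp : ℕ).Prime := ⟨pp.2⟩
        Real.log ‖t pp i x‖ = -((pilotDataOfK T.D T.K).thetaPilot i (placeOf (pilotDataOfK T.D T.K) pp.1 x)) *
          logNorm T.K (placeOf (pilotDataOfK T.D T.K) pp.1 x) / localDegree T.K (placeOf (pilotDataOfK T.D T.K) pp.1 x))
      (_htq : ∀ (pp : Nat.Primes) (x : (thetaIndex (pilotDataOfK T.D T.K)).Fibre (.inr pp)),
        haveI : Fact (pp : ℕ).Prime := ⟨pp.2⟩
        Real.log ‖tq pp x‖ = -((pilotDataOfK T.D T.K).qPilot (placeOf (pilotDataOfK T.D T.K) pp.1 x)) *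
          logNorm T.K (placeOf (pilotDataOfK T.D T.K) pp.1 x) / localDegree T.K (placeOf (pilotDataOfK T.D T.K) pp.1 x)),
      Thm311ToCor312.Licence
        (settingPrVolSharp (pilotDataOfK T.D T.K) hlog M archPk archSub Ψ act Mmod region n lat sig split qData tq t htq0 htq1) := by
  refine WRow.licence_frey37569208117_gap1019_of_thirty T fun x₀ => ?_
  have hpole : ∀ v : HeightOneSpectrum (𝓞 ℚ), Rat.HeightOneSpectrum.natGenerator v = ((⟨7, by norm_num⟩ : Nat.Primes) : ℕ) →
      ord ℚ v (jInv (((7 ^ 11 * 19 : ℕ) : ℚ) / (2 ^ 28 * 3 ^ 12 * 11 ^ 3 * 67 : ℕ))) = -(2 * ((11 : ℕ) : ℤ)) := fun v hv =>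
    WRow.ord_jInv_frey37569208117_seven v hv
  have h := GenuineK.absRamificationIdx_kOf_eq_thirty_mul_of_isSquare T ⟨7, by norm_num⟩ (by norm_num) (by norm_num) (by norm_num) (by norm_num)
    (by norm_num) hpole (by norm_num) hsq ord_seven_lam x₀
  norm_num at h
  exact h

/-- **`√λ ∈ F` ⟹ branch C's «∃ ρ qK, QPinned ∧ PilotKummerCompatHull» at `l = 1019`** (any columns; every pair of realising ideles).
[cite: Mochizuki2012, IUTchIII Cor. 3.12 Step (xi-d) p. 183, (xi-f) p. 184] [claim: Mochizuki2012, status: disputed] -/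
theorem WRow.exists_qPinned_and_hull_frey37569208117_gap1019_of_isSquare (T : Cor22.ThetaVolumeDatumAt (ratPoint (((7 ^ 11 * 19 : ℕ) : ℚ) / (2 ^ 28 * 3 ^ 12 * 11 ^ 3 * 67 : ℕ))) 1019)
    (hsq : letI := T.instFieldF; letI := T.instAlgebraF
      IsSquare (algebraMap (ratPoint (((7 ^ 11 * 19 : ℕ) : ℚ) / (2 ^ 28 * 3 ^ 12 * 11 ^ 3 * 67 : ℕ))).F T.F
        ((((7 ^ 11 * 19 : ℕ) : ℚ) / (2 ^ 28 * 3 ^ 12 * 11 ^ 3 * 67 : ℕ) : ℚ)))) :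
    letI := T.instFieldF; letI := T.instNumberFieldF; letI := T.instAlgebraF; letI := T.instFieldK
    letI := T.instNumberFieldK; letI := T.instAlgebraK; letI := T.instFieldFbar; letI := T.instAlgebraFbar
    letI := T.instAlgebraKFbar; letI := T.instIsElliptic
    ∀ {logv : PadicLogs T.K} (hlog : LogvAnalytic logv) (M : Type) [Field M] [NumberField M]
      (archPk : ∀ (j : (thetaIndex (pilotDataOfK T.D T.K)).Label) (vQ : (thetaIndex (pilotDataOfK T.D T.K)).VQ),
        Set ((logShellsDH (pilotDataOfK T.D T.K) logv).Packet j vQ))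
      (archSub : ∀ (j : (thetaIndex (pilotDataOfK T.D T.K)).Label) (v : (thetaIndex (pilotDataOfK T.D T.K)).V),
        Set ((logShellsDH (pilotDataOfK T.D T.K) logv).Packet j ((thetaIndex (pilotDataOfK T.D T.K)).over v)))
      (Ψ : ℤ → ∀ v : (thetaIndex (pilotDataOfK T.D T.K)).V, v ∈ (thetaIndex (pilotDataOfK T.D T.K)).Vbad →
        Set ((logShellsDH (pilotDataOfK T.D T.K) logv).StarPacket v))
      (act : ℤ → ∀ v : (thetaIndex (pilotDataOfK T.D T.K)).V, v ∈ (thetaIndex (pilotDataOfK T.D T.K)).Vbad →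
        (logShellsDH (pilotDataOfK T.D T.K) logv).StarPacket v → Module.End ℚ ((logShellsDH (pilotDataOfK T.D T.K) logv).StarPacket v))
      (Mmod : ℤ → ∀ j : (thetaIndex (pilotDataOfK T.D T.K)).LabelStar, Set ((logShellsDH (pilotDataOfK T.D T.K) logv).GlobalPacket j.1))
      (region : ℤ → ∀ j : (thetaIndex (pilotDataOfK T.D T.K)).LabelStar, FinDivisor M → ∀ vQ : (thetaIndex (pilotDataOfK T.D T.K)).VQ,
        Set ((logShellsDH (pilotDataOfK T.D T.K) logv).Packet j.1 vQ))
      (n : ℤ) {HT : Type} {LogLink : HT → HT → Type} {IsFull : ∀ {s t : HT}, LogLink s t → Prop}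
      (lat : LGPGaussianLogThetaLattice LogLink IsFull)
      {Frd : Type} {IsoF : Frd → Frd → Type} {Ob : Frd → Type} {realify : Frd → Frd} {Strip : Type}
      {IsoS : Strip → Strip → Type} {Mv : ∀ v : (thetaIndex (pilotDataOfK T.D T.K)).V, v ∈ (thetaIndex (pilotDataOfK T.D T.K)).Vbad → Type}
      [∀ v h, Monoid (Mv v h)]
      (sig : GlobalLGPFrobenioidSignature (thetaIndex (pilotDataOfK T.D T.K)).lstar (thetaIndex (pilotDataOfK T.D T.K)).V
        (· ∈ (thetaIndex (pilotDataOfK T.D T.K)).Vbad) Frd IsoF Ob realify Strip IsoS Mv)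
      (split : SplittingMonoids Mv) {ObΔ : Type} {N : ∀ v : (thetaIndex (pilotDataOfK T.D T.K)).V, v ∈ (thetaIndex (pilotDataOfK T.D T.K)).Vbad → Type}
      [∀ v h, Monoid (N v h)] (qData : QPilotData ObΔ N)
      (tq : ∀ (pp : Nat.Primes) (x : (thetaIndex (pilotDataOfK T.D T.K)).Fibre (.inr pp)),
        haveI : Fact (pp : ℕ).Prime := ⟨pp.2⟩; kOf (pilotDataOfK T.D T.K) pp.1 x)
      (t : ∀ (pp : Nat.Primes) (_ : Fin (pilotDataOfK T.D T.K).lstar) (x : (thetaIndex (pilotDataOfK T.D T.K)).Fibre (.inr pp)),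
        haveI : Fact (pp : ℕ).Prime := ⟨pp.2⟩; kOf (pilotDataOfK T.D T.K) pp.1 x)
      (htq0 : ∀ pp x, tq pp x ≠ 0)
      (htq1 : ∀ (pp : Nat.Primes) (x : (thetaIndex (pilotDataOfK T.D T.K)).Fibre (.inr pp)),
        haveI : Fact (pp : ℕ).Prime := ⟨pp.2⟩; placeOf (pilotDataOfK T.D T.K) pp.1 x ∉ (pilotDataOfK T.D T.K).S → ‖tq pp x‖ = 1)
      (col : ℤ → Column (logShellsDH (pilotDataOfK T.D T.K) logv))
      (_ht0 : ∀ pp i x, t pp i x ≠ 0)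
      (_ht : ∀ (pp : Nat.Primes) (i : Fin (pilotDataOfK T.D T.K).lstar) (x : (thetaIndex (pilotDataOfK T.D T.K)).Fibre (.inr pp)),
        haveI : Fact (pp : ℕ).Prime := ⟨pp.2⟩
        Real.log ‖t pp i x‖ = -((pilotDataOfK T.D T.K).thetaPilot i (placeOf (pilotDataOfK T.D T.K) pp.1 x)) *
          logNorm T.K (placeOf (pilotDataOfK T.D T.K) pp.1 x) / localDegree T.K (placeOf (pilotDataOfK T.D T.K) pp.1 x))
      (_htq : ∀ (pp : Nat.Primes) (x : (thetaIndex (pilotDataOfK T.D T.K)).Fibre (.inr pp)),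
        haveI : Fact (pp : ℕ).Prime := ⟨pp.2⟩
        Real.log ‖tq pp x‖ = -((pilotDataOfK T.D T.K).qPilot (placeOf (pilotDataOfK T.D T.K) pp.1 x)) *
          logNorm T.K (placeOf (pilotDataOfK T.D T.K) pp.1 x) / localDegree T.K (placeOf (pilotDataOfK T.D T.K) pp.1 x)),
      ∃ (ρ : (∀ v : (thetaIndex (pilotDataOfK T.D T.K)).V, v ∈ (thetaIndex (pilotDataOfK T.D T.K)).Vbad →
              Set ((logShellsDH (pilotDataOfK T.D T.K) logv).StarPacket v)) →
            ∀ (j : (thetaIndex (pilotDataOfK T.D T.K)).Label) (vQ : (thetaIndex (pilotDataOfK T.D T.K)).VQ),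
              Set ((logShellsDH (pilotDataOfK T.D T.K) logv).Packet j vQ))
          (qK : ∀ v : (thetaIndex (pilotDataOfK T.D T.K)).V, v ∈ (thetaIndex (pilotDataOfK T.D T.K)).Vbad →
            Set ((logShellsDH (pilotDataOfK T.D T.K) logv).StarPacket v)),
          QPinned ({ toSituation := situationPrVol (pilotDataOfK T.D T.K) hlog M archPk archSub Ψ act Mmod region, col := col } :
              LatticeSituation (thetaIndex (pilotDataOfK T.D T.K)))
            (settingPrVolSharp (pilotDataOfK T.D T.K) hlog M archPk archSub Ψ act Mmod region n lat sig split qData tq t htq0 htq1) ρ qK ∧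
          PilotKummerCompatHull ({ toSituation := situationPrVol (pilotDataOfK T.D T.K) hlog M archPk archSub Ψ act Mmod region, col := col } :
              LatticeSituation (thetaIndex (pilotDataOfK T.D T.K)))
            (settingPrVolSharp (pilotDataOfK T.D T.K) hlog M archPk archSub Ψ act Mmod region n lat sig split qData tq t htq0 htq1) ρ qK := by
  refine WRow.exists_qPinned_and_hull_frey37569208117_gap1019_of_thirty T fun x₀ => ?_
  have hpole : ∀ v : HeightOneSpectrum (𝓞 ℚ), Rat.HeightOneSpectrum.natGenerator v = ((⟨7, by norm_num⟩ : Nat.Primes) : ℕ) →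
      ord ℚ v (jInv (((7 ^ 11 * 19 : ℕ) : ℚ) / (2 ^ 28 * 3 ^ 12 * 11 ^ 3 * 67 : ℕ))) = -(2 * ((11 : ℕ) : ℤ)) := fun v hv =>
    WRow.ord_jInv_frey37569208117_seven v hv
  have h := GenuineK.absRamificationIdx_kOf_eq_thirty_mul_of_isSquare T ⟨7, by norm_num⟩ (by norm_num) (by norm_num) (by norm_num) (by norm_num)
    (by norm_num) hpole (by norm_num) hsq ord_seven_lam x₀
  norm_num at h
  exact h

end Summit.ABC.IUTFork.Conditional

end
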